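import Summits.QuantumFields.YangMills.Theorems.F4SubCurvatureDoorLaplaceFourierRegistered
import Summits.QuantumFields.YangMills.Theorems.F4SubCurvatureDoorRationalToGeneralPringsheimCore
import Literature.Barriers.CriticalPhenomena.LongRangeTrivialityOnZ3TorusZeroMode
import Mathlib
import HarnessLib

/-!
# S1 programme (⟨stmt-QuantumFields-23125⟩) — glue `pringsheimIdentification_of_lukacsOneDim : LukacsOneDim → PringsheimIdentification`

Crux `F4SubCurvatureDoor.RationalToGeneral` ⟨stmt-QuantumFields-23125⟩, owner file `Cruxes/RationalToGeneral/Lines/forward_cone_rungs.lean`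
(ns `…ForwardConeRungs`, v4/v5).  This file restates R-S1ℓ `LukacsOneDim` and `PringsheimIdentification` CHARACTER-IDENTICALLY and proves the
second from the first (`pringsheimIdentification_of_lukacsOneDim`).  (`LukacsOneDim` unfolded is the tree theorem
`F4SubCurvatureDoorForwardConeLukacs.exists_expMoment_of_analyticAt_cosTransform` of width seat w3 g37, p718973; the by-name
`pringsheimIdentification_holds` is the two-line sequel file `…PringsheimIdentification`, kept separate only because of module build order.)

PROOF.  Fix the axis `j` and push the weighted measure `e^{−tE} μ` forward to `ℝ` under `q⃗ ↦ q_j`: a finite measure `m` whose cosine transform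
`φ(s) = ∫ cos(sq) dm = ∫ e^{−tE} cos(s q_j) dμ` is, on `(−ρ, ρ)`, the restriction `g(s) = G(s e_j)` of the holomorphic `G` (the hypothesis of
`PringsheimIdentification`), hence real-analytic at `0`; `LukacsOneDim` gives an exponential moment `∫ e^{δ₀|q|} dm < ∞`; the one-dimensional
Pringsheim step `…PringsheimCore.cosh_integral_le_of_holomorphic` (identity theorem near `0`, uniqueness of the Taylor series of `g` at `0`,
evaluation at `iδ`, Tonelli) upgrades it to `∫ cosh(δq) dm ≤ M` for every `δ < ρ`; finally `e^{|x|} ≤ 2 cosh x`.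

HONEST LABEL: glue between rungs of the OPEN stub S1 of the OPEN lines g21-A/B; nothing of S1,
⟨23125⟩, ⟨23035⟩, R2d is proved and the Yang–Mills mass gap is NOT proved; no summit is proved by a line.  Lead seat `ym-line-sfw-p2` g75 (cell
ym-idea-1, free hands).
-/

set_option autoImplicit false

noncomputable section

open MeasureTheory Filter Topology Set Metric
open scoped BigOperators NNReal ENNReal

namespace Summit.QuantumFields.YangMills.Theorems.F4SubCurvatureDoorPringsheimOfLukacsRegistered

open Summit.QuantumFields.YangMills.Theorems.F4SubCurvatureDoorLaplaceFourierRegistered (E4 E3 InClass timeSpace IsLF)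
open Summit.QuantumFields.YangMills.Theorems.F4SubCurvatureDoorPringsheimCore (cosh_integral_le_of_holomorphic)
open Literature.Barriers.CriticalPhenomena.LongRangeIsing (exp_abs_le_two_mul_cosh)

/-! ## The two Props (character-identical with `Lines/forward_cone_rungs.lean` v4) -/

/-- R-S1ℓ «LUKACS, ONE-DIMENSIONAL» (M; [Lukacs 1970, Thm 7.1.1]; elementary: analyticity of the cosine transform at `0` bounds the even moments by
`C (2k)!/ρ^{2k}`, and `∫ cosh(δq) dm = Σ m_{2k} δ^{2k}/(2k)!` by Tonelli): a finite positive measure on `ℝ` whose cosine transform is real-analytic at `0`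
has an exponential moment.  The three spatial coordinate directions + Hölder then give `SpatialExponentialMoments` from analyticity of `x⃗ ↦ K(t, x⃗)` at
`x⃗ = 0` (which is `CrossAnalyticity` ∘ `DirectionalExtension`). -/
def LukacsOneDim : Prop :=
  ∀ (m : Measure ℝ), IsFiniteMeasure m → ∀ φ : ℝ → ℝ, (∀ s : ℝ, φ s = ∫ q, Real.cos (s * q) ∂m) → AnalyticAt ℝ φ 0 →
    ∃ δ : ℝ, 0 < δ ∧ Integrable (fun q : ℝ => Real.exp (δ * |q|)) m


/-- «PRINGSHEIM IDENTIFICATION» (M; Vivanti–Pringsheim for cosine transforms of positive measures, three variables): if the spatial slice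
`x⃗ ↦ K(t, x⃗) = ∫ e^{−tE} cos(q⃗·x⃗) dμ` is the restriction of a function holomorphic and bounded by `M` on the complex sup-ball of radius `ρ` about `0`,
then the exponential moments up to aperture `ρ` exist and are bounded by `2M` along every coordinate direction. -/
def PringsheimIdentification : Prop :=
  ∀ (μ : Measure (ℝ × E3)) (t ρ M : ℝ), 0 < t → 0 < ρ →
    Integrable (fun p : ℝ × E3 => Real.exp (-(t * p.1))) μ →
    (∃ G : (Fin 3 → ℂ) → ℂ, DifferentiableOn ℂ G (Metric.ball 0 ρ) ∧ (∀ z ∈ Metric.ball (0 : Fin 3 → ℂ) ρ, ‖G z‖ ≤ M) ∧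
        ∀ y : Fin 3 → ℝ, (∀ j, |y j| < ρ) →
          G (fun j => ((y j : ℝ) : ℂ)) = ((∫ p : ℝ × E3, Real.exp (-(t * p.1)) * Real.cos (∑ j, p.2 j * y j) ∂μ : ℝ) : ℂ)) →
    ∀ (j : Fin 3) (δ : ℝ), 0 < δ → δ < ρ →
      Integrable (fun p : ℝ × E3 => Real.exp (-(t * p.1) + δ * |p.2 j|)) μ ∧
      ∫ p : ℝ × E3, Real.exp (-(t * p.1) + δ * |p.2 j|) ∂μ ≤ 2 * M


/-! ## The weighted axis marginal `m = (q⃗ ↦ q_j)_* (e^{−tE} μ)` -/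

/-- The Laplace weight `e^{−tE}` as an `ℝ≥0`-valued density. -/
def wt (t : ℝ) (p : ℝ × E3) : ℝ≥0 := Real.toNNReal (Real.exp (-(t * p.1)))

/-- The weight is measurable. -/
theorem measurable_wt (t : ℝ) : Measurable (wt t) := by
  unfold wt; fun_prop

/-- The weight, coerced back to `ℝ`. -/
theorem coe_wt (t : ℝ) (p : ℝ × E3) : ((wt t p : ℝ≥0) : ℝ) = Real.exp (-(t * p.1)) :=
  Real.coe_toNNReal _ (Real.exp_pos _).le

/-- The weighted axis marginal. -/
def marg (μ : Measure (ℝ × E3)) (t : ℝ) (j : Fin 3) : Measure ℝ :=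
  (μ.withDensity fun p => (wt t p : ℝ≥0∞)).map fun p => p.2 j

/-- Integrals against the marginal (continuous integrands). -/
theorem integral_marg (μ : Measure (ℝ × E3)) (t : ℝ) (j : Fin 3) {φ : ℝ → ℝ} (hφ : Continuous φ) :
    ∫ q, φ q ∂(marg μ t j) = ∫ p : ℝ × E3, Real.exp (-(t * p.1)) * φ (p.2 j) ∂μ := by
  rw [marg, integral_map (by fun_prop) hφ.aestronglyMeasurable, integral_withDensity_eq_integral_smul (measurable_wt t)]
  refine integral_congr_ae (ae_of_all _ fun p => ?_)
  simp only [NNReal.smul_def, coe_wt, smul_eq_mul]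

/-- Integrability against the marginal (continuous integrands). -/
theorem integrable_marg_iff (μ : Measure (ℝ × E3)) (t : ℝ) (j : Fin 3) {φ : ℝ → ℝ} (hφ : Continuous φ) :
    Integrable φ (marg μ t j) ↔ Integrable (fun p : ℝ × E3 => Real.exp (-(t * p.1)) * φ (p.2 j)) μ := by
  rw [marg, integrable_map_measure hφ.aestronglyMeasurable (by fun_prop),
    integrable_withDensity_iff_integrable_smul (measurable_wt t)]
  refine integrable_congr (ae_of_all _ fun p => ?_)
  simp only [Function.comp_apply, NNReal.smul_def, coe_wt, smul_eq_mul]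

/-- The marginal is finite when `e^{−tE}` is integrable. -/
theorem isFiniteMeasure_marg (μ : Measure (ℝ × E3)) (t : ℝ) (j : Fin 3)
    (hint : Integrable (fun p : ℝ × E3 => Real.exp (-(t * p.1))) μ) : IsFiniteMeasure (marg μ t j) := by
  have hfin : IsFiniteMeasure (μ.withDensity fun p => (wt t p : ℝ≥0∞)) := by
    refine isFiniteMeasure_withDensity ?_
    have h := (hasFiniteIntegral_iff_ofReal (ae_of_all _ fun p : ℝ × E3 => (Real.exp_pos (-(t * p.1))).le)).1 hint.2
    exact h.ne
  unfold marg
  exact Measure.isFiniteMeasure_map _ _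

/-! ## The glue -/

/-- **GLUE: `LukacsOneDim → PringsheimIdentification`.** -/
theorem pringsheimIdentification_of_lukacsOneDim (hL : LukacsOneDim) : PringsheimIdentification := by
  intro μ t ρ M ht hρ hint hG j δ hδ hδρ
  obtain ⟨G, hGd, hGb, hGr⟩ := hG
  haveI := isFiniteMeasure_marg μ t j hint
  -- the restriction of `G` to the `j`-th complex axis
  set g : ℂ → ℂ := fun w => G (Pi.single j w) with hg
  have hsingle : Differentiable ℂ (fun w : ℂ => (Pi.single j w : Fin 3 → ℂ)) := by
    refine differentiable_pi.mpr fun i => ?_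
    by_cases hij : i = j
    · subst hij; simp only [Pi.single_eq_same]; exact differentiable_id
    · simp only [Pi.single_eq_of_ne hij]; exact differentiable_const _
  have hmaps : MapsTo (fun w : ℂ => (Pi.single j w : Fin 3 → ℂ)) (Metric.ball 0 ρ) (Metric.ball 0 ρ) := by
    intro w hw
    rw [mem_ball_zero_iff] at hw ⊢
    rwa [Pi.norm_single]
  have hgd : DifferentiableOn ℂ g (Metric.ball 0 ρ) := hGd.comp hsingle.differentiableOn hmaps
  have hgb : ∀ w ∈ Metric.ball (0 : ℂ) ρ, ‖g w‖ ≤ M := fun w hw => hGb _ (hmaps hw)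
  have hgr : ∀ s : ℝ, |s| < ρ → g (s : ℂ) = ((∫ q : ℝ, Real.cos (s * q) ∂(marg μ t j) : ℝ) : ℂ) := by
    intro s hs
    have hy : ∀ i : Fin 3, |(Pi.single j s : Fin 3 → ℝ) i| < ρ := by
      intro i
      by_cases hij : i = j
      · subst hij; simpa using hs
      · simp [Pi.single_eq_of_ne hij, hρ]
    have h1 := hGr (Pi.single j s) hy
    have hcoe : (fun i => (((Pi.single j s : Fin 3 → ℝ) i : ℝ) : ℂ)) = Pi.single j (s : ℂ) := by
      funext i
      by_cases hij : i = j
      · subst hij; simp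
      · simp [Pi.single_eq_of_ne hij]
    rw [hcoe] at h1
    show G (Pi.single j (s : ℂ)) = _
    rw [h1, integral_marg μ t j (by fun_prop : Continuous fun q : ℝ => Real.cos (s * q))]
    congr 1
    refine integral_congr_ae (ae_of_all _ fun p => ?_)
    simp [Pi.single_apply, mul_comm]
  -- the cosine transform of the marginal is real-analytic at `0`
  set φ : ℝ → ℝ := fun s => ∫ q : ℝ, Real.cos (s * q) ∂(marg μ t j) with hφ
  have hφan : AnalyticAt ℝ φ 0 := by
    have hga : AnalyticAt ℂ g 0 := hgd.analyticAt (Metric.isOpen_ball.mem_nhds (Metric.mem_ball_self hρ))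
    have h1 : AnalyticAt ℝ (fun s : ℝ => g (s : ℂ)) 0 :=
      (hga.restrictScalars (𝕜 := ℝ)).comp_of_eq (Complex.ofRealCLM.analyticAt 0) (by simp)
    have h2 : AnalyticAt ℝ (fun s : ℝ => (g (s : ℂ)).re) 0 := (Complex.reCLM.analyticAt _).comp h1
    refine h2.congr ?_
    filter_upwards [Metric.ball_mem_nhds (0 : ℝ) hρ] with s hs
    rw [mem_ball_zero_iff, Real.norm_eq_abs] at hs
    show (g (s : ℂ)).re = φ s
    rw [hgr s hs, Complex.ofReal_re]
  -- Lukacs: an initial exponential moment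
  obtain ⟨δ₀, hδ₀, hexp⟩ := hL (marg μ t j) inferInstance φ (fun s => rfl) hφan
  -- the Pringsheim step
  obtain ⟨hcosh, hle⟩ := cosh_integral_le_of_holomorphic hρ g hgd hgb hgr hδ₀ hexp hδ hδρ
  -- back to `μ`
  have hcont : Continuous fun q : ℝ => Real.cosh (δ * q) := by fun_prop
  have hcoshμ : Integrable (fun p : ℝ × E3 => Real.exp (-(t * p.1)) * Real.cosh (δ * p.2 j)) μ :=
    (integrable_marg_iff μ t j hcont).1 hcosh
  have hval : ∫ p : ℝ × E3, Real.exp (-(t * p.1)) * Real.cosh (δ * p.2 j) ∂μ ≤ M := by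
    rw [← integral_marg μ t j hcont]; exact hle
  have hpt : ∀ p : ℝ × E3, Real.exp (-(t * p.1) + δ * |p.2 j|) ≤ 2 * (Real.exp (-(t * p.1)) * Real.cosh (δ * p.2 j)) := by
    intro p
    rw [Real.exp_add]
    have h1 : Real.exp (δ * |p.2 j|) ≤ 2 * Real.cosh (δ * p.2 j) := by
      have := exp_abs_le_two_mul_cosh (δ * p.2 j)
      rwa [abs_mul, abs_of_pos hδ] at this
    have h0 : 0 < Real.exp (-(t * p.1)) := Real.exp_pos _
    nlinarith
  have hI : Integrable (fun p : ℝ × E3 => Real.exp (-(t * p.1) + δ * |p.2 j|)) μ :=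
    Integrable.mono' (hcoshμ.const_mul 2) (by fun_prop) (ae_of_all _ fun p => by
      rw [Real.norm_eq_abs, abs_of_pos (Real.exp_pos _)]; exact hpt p)
  refine ⟨hI, ?_⟩
  calc ∫ p : ℝ × E3, Real.exp (-(t * p.1) + δ * |p.2 j|) ∂μ
      ≤ ∫ p : ℝ × E3, 2 * (Real.exp (-(t * p.1)) * Real.cosh (δ * p.2 j)) ∂μ := integral_mono hI (hcoshμ.const_mul 2) hpt
    _ = 2 * ∫ p : ℝ × E3, Real.exp (-(t * p.1)) * Real.cosh (δ * p.2 j) ∂μ := integral_const_mul _ _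
    _ ≤ 2 * M := by linarith

end Summit.QuantumFields.YangMills.Theorems.F4SubCurvatureDoorPringsheimOfLukacsRegistered

end
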